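import Mathlib
import HarnessLib
import Literature.Analysis.FluidPDE.BeltramiFlows
import Summits.NavierStokesRegularity.FluidComputer.ABCAlphaPointStrain

/-!
# The host strain along the WHOLE rope-carrying line of the ABC 1:1:1 flow is exactly axisymmetric:
# `S(s) = (σ(s)/2)·(𝟙𝟙ᵀ − I)`, axial rate `σ(s) = cos s − sin s = √2·cos(d/√3)` at arclength `d` from the α-point
# (instab lane, door O-acc = O7 / obstruction P3 — soft spot (s4) of `HOME/instab2/HEREDITY-P3.md` «the rope slides
# and fattens»; the I2-SCORE readings `a_rope` / `a_sat` of the P-TOWER stage-1 census; cell `ns-blowup`, seat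
# `ns-blowup-instab2`)

HONEST FRAMING (human ruling D-0035): this cell ATTEMPTS the negative direction of the Clay problem; nothing in this
file is a claim about the Navier–Stokes equations. WHAT THIS IS NOT: not dynamics — evaluation of the Jacobian
`J = Literature.Analysis.FluidPDE.ABC.jac 1 1 1` (row `j` = `∂/∂xⱼ`, column `i` = component) of the tree's ABC field
`U = abc 1 1 1` on the invariant diagonal `{(s,s,s)}` — the straight heteroclinic streamline from `α₀ = (7π/4)·𝟙` down
to `β₀ = (3π/4)·𝟙` (`ABCAlphaPointStrain`: invariant line, along-line speed `sin s + cos s`, length `π√3`), on which the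
P-TOWER MODEL's level-1 ROPE sits and SLIDES.

## Why the cell wants it
`ABCAlphaPointStrain` (p407903) proved that AT THE α-POINT the host strain is the axisymmetric Burgers strain
`diag(σ_α, −σ_α/2, −σ_α/2)`, `σ_α = √2` — the dictionary entry `A_{k−1} ≡ σ_α` of NORMALISATIONS-OF-RECORD §1 and the
«parent strain σ» of the heredity lemmas (`BurgersTubeHeredity`, `BurgersColumnarFlowMap`). The stage-1 data then showed
the rope does not sit at `α`: it forms on the separatrix, SLIDES toward `α` and saturates before arriving (I2 SCORE
lines; HEREDITY-P3 §9 (s4) «only approximately columnar near α»). This file says what strain the host offers at EVERY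
station of the line: still EXACTLY axisymmetric about the line (so the columnar idealisation of lemmas (A)/(B) is exact
in shape all along it), with axial rate `σ(s) = cos s − sin s` — `+√2` at `α₀`, `0` at the midpoint `(5π/4)·𝟙`, `−√2`
at `β₀`; in arclength `d` from the α-point, `σ = σ_α·cos(d/√3)`. A rope segment centred a distance `d` up-line from
`α` is therefore strained at the KNOWN fraction `cos(d/√3)` of `σ_α` (e.g. `d = 1` ⇒ `0.838 σ_α`; half strain at
`d = π√3/3 ≈ 1.81`), and the β-ward half of the line is axially COMPRESSIVE (sheet-forming) — numbers the census can
put beside `a_rope`, `a_sat` and the θ-attribution instead of the single constant `σ_α`.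

## What is proved (Mathlib + `BeltramiFlows` + `ABCAlphaPointStrain`; no definitions)
* §1 `jac_diag` (the Jacobian on the diagonal), `strain_diag` (symmetric part `½(J + Jᵀ) = (σ(s)/2)(𝟙𝟙ᵀ − I)` with
  `σ(s) = cos s − sin s`), `strain_diag_mulVec_ones` (`S𝟙 = σ(s)𝟙`: the line direction is a strain axis with rate
  `σ(s)`), `strain_diag_mulVec_transverse` (`Sv = −(σ(s)/2)v` for `v ⊥ 𝟙`: the normal plane contracts/expands
  ISOTROPICALLY at `−σ(s)/2` — EXACT AXISYMMETRY all along the line), `strain_diag_trace`;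
* §2 `rotation_diag` (antisymmetric part `½(J − Jᵀ)` = cross product with `½U`, `U = (sin s + cos s)𝟙` on the line —
  the host's own vorticity there is ALONG the line: solid-body rotation of the normal plane at rate `(sin s + cos s)/2`,
  vanishing exactly at `α₀`, `β₀`), via `abc_diag` of `ABCAlphaPointStrain`;
* §3 the axial-rate profile: `axialRate_eq_sqrt_two_mul_cos` (`cos s − sin s = √2 cos(s − 7π/4)`),
  `axialRate_arclength` (`= √2 cos(d/√3)` at the point `(7π/4 − d/√3)·𝟙`, arclength `d` from `α₀`), the value
  `axialRate_mid = 0` (at `5π/4`; the end values `±√2` at `α₀`/`β₀` are `ABCAlphaPointStrain.alongLine_rate_alpha/_beta`),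
  signs `axialRate_pos` on
  `s ∈ (5π/4, 7π/4]`-ward stations (`5π/4 < s < 9π/4`) and `axialRate_neg` on `(π/4, 5π/4)`, the bound
  `abs_axialRate_le` (`|σ(s)| ≤ √2 = σ_α`: the α-point is the most stretching station), and
  `axialRate_eq_deriv_speed` (σ is the `s`-derivative of the along-line speed `sin s + cos s` — one-dimensional
  continuity on the invariant line; `ABCAlphaPointStrain.hasDerivAt_alongLine`);
* §4 numbers for the census: `cos_one_div_sqrt_three_bounds` (`0.833 < cos(1/√3) < 0.84`: a rope centred one code
  unit up-line from α feels `≈ 0.838 σ_α`) and `axialRate_half_station` (`σ = σ_α/2` at `d = π√3/3`, i.e. `s = 7π/4 − π/3`).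
LABEL: MODEL-door kinematics (the host's strain offer along the rope's track). WHAT THIS IS NOT: not NS; no flow evolved.
-/

namespace Summit.NavierStokesRegularity.FluidComputer.ABCDiagonalStrainProfile

open Real Literature.Analysis.FluidPDE

/-! ## §1 The Jacobian and the strain on the diagonal -/

/-- The Jacobian of `U = abc 1 1 1` at the diagonal point `(s,s,s)`:
`[[0, cos s, −sin s], [−sin s, 0, cos s], [cos s, −sin s, 0]]` (row `j` = `∂/∂xⱼ`). -/
theorem jac_diag (s : ℝ) :
    ABC.jac 1 1 1 (!₂[s, s, s] : EuclideanSpace ℝ (Fin 3)) =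
      ![![0, Real.cos s, -Real.sin s], ![-Real.sin s, 0, Real.cos s], ![Real.cos s, -Real.sin s, 0]] := by
  simp [ABC.jac]

/-- THE STRAIN ON THE LINE: `½(J + Jᵀ) = ((cos s − sin s)/2)·(𝟙𝟙ᵀ − I)` — zero diagonal, all off-diagonal entries
equal to `(cos s − sin s)/2`. -/
theorem strain_diag (s : ℝ) (j i : Fin 3) :
    (ABC.jac 1 1 1 (!₂[s, s, s] : EuclideanSpace ℝ (Fin 3)) j i +
        ABC.jac 1 1 1 (!₂[s, s, s] : EuclideanSpace ℝ (Fin 3)) i j) / 2 =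
      if j = i then 0 else (Real.cos s - Real.sin s) / 2 := by
  fin_cases j <;> fin_cases i <;> simp [ABC.jac] <;> ring

/-- AXIAL RATE: the line direction `𝟙 = (1,1,1)` is an eigenvector of the strain with eigenvalue
`σ(s) = cos s − sin s`: `Σⱼ 1·Sⱼᵢ = σ(s)·1`. -/
theorem strain_diag_mulVec_ones (s : ℝ) (i : Fin 3) :
    ∑ j : Fin 3, (1 : ℝ) * ((ABC.jac 1 1 1 (!₂[s, s, s] : EuclideanSpace ℝ (Fin 3)) j i +
        ABC.jac 1 1 1 (!₂[s, s, s] : EuclideanSpace ℝ (Fin 3)) i j) / 2) = (Real.cos s - Real.sin s) * 1 := by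
  simp only [strain_diag, Fin.sum_univ_three]
  fin_cases i <;> simp

/-- TRANSVERSE RATE: every `v` normal to the line (`v₀ + v₁ + v₂ = 0`) is an eigenvector with eigenvalue `−σ(s)/2`.
With `strain_diag_mulVec_ones`: the host strain is EXACTLY AXISYMMETRIC about the line at every station,
`S(s) = diag(σ(s), −σ(s)/2, −σ(s)/2)` in any orthonormal frame `(𝟙/√3, e₂, e₃)`. -/
theorem strain_diag_mulVec_transverse (s : ℝ) (v : Fin 3 → ℝ) (hv : v 0 + v 1 + v 2 = 0) (i : Fin 3) :
    ∑ j : Fin 3, v j * ((ABC.jac 1 1 1 (!₂[s, s, s] : EuclideanSpace ℝ (Fin 3)) j i +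
        ABC.jac 1 1 1 (!₂[s, s, s] : EuclideanSpace ℝ (Fin 3)) i j) / 2) =
      -((Real.cos s - Real.sin s) / 2) * v i := by
  simp only [strain_diag, Fin.sum_univ_three]
  fin_cases i <;> simp <;> linear_combination ((Real.cos s - Real.sin s) / 2) * hv

/-- Incompressibility on the line: `tr S(s) = σ − σ/2 − σ/2 = 0` (indeed `tr J = 0`). -/
theorem strain_diag_trace (s : ℝ) :
    ∑ i : Fin 3, ABC.jac 1 1 1 (!₂[s, s, s] : EuclideanSpace ℝ (Fin 3)) i i = 0 := by
  simp [jac_diag, Fin.sum_univ_three]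

/-! ## §2 The rotation on the diagonal: the host's vorticity is along the line -/

/-- THE ROTATION ON THE LINE: `½(J − Jᵀ)` has entries `±(cos s + sin s)/2`; precisely
`½(Jⱼᵢ − Jᵢⱼ) = ((sin s + cos s)/2)·εⱼᵢₖ𝟙ₖ` summed over `k`, i.e. the antisymmetric part is the cross product with
`½U(s,s,s) = ½(sin s + cos s)𝟙` — the Beltrami host's vorticity `curl U = U` points ALONG the line there, so the
normal plane turns rigidly at rate `(sin s + cos s)/2` and does not shear. Entrywise: -/
theorem rotation_diag (s : ℝ) (j i : Fin 3) :
    (ABC.jac 1 1 1 (!₂[s, s, s] : EuclideanSpace ℝ (Fin 3)) j i -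
        ABC.jac 1 1 1 (!₂[s, s, s] : EuclideanSpace ℝ (Fin 3)) i j) / 2 =
      if j = i then 0
      else if (j = 0 ∧ i = 1) ∨ (j = 1 ∧ i = 2) ∨ (j = 2 ∧ i = 0) then (Real.cos s + Real.sin s) / 2
      else -((Real.cos s + Real.sin s) / 2) := by
  fin_cases j <;> fin_cases i <;> simp [ABC.jac] <;> ring

/-- The rotation rate vanishes exactly where the along-line speed does — at the stagnation points `α₀`, `β₀`
(`sin s + cos s = 0`); there `J` is symmetric (`ABCAlphaPointStrain.jac_alpha0_symm`). On the line the host field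
itself is `(sin s + cos s)𝟙` (`ABCAlphaPointStrain.abc_diag`), so «rotation rate = half the local host speed». -/
theorem rotation_rate_eq_half_speed (s : ℝ) :
    (Real.cos s + Real.sin s) / 2 = (ABC.abc 1 1 1 (!₂[s, s, s] : EuclideanSpace ℝ (Fin 3)) 0) / 2 := by
  simp [ABC.abc]; ring

/-! ## §3 The axial-rate profile `σ(s) = cos s − sin s` along the line -/

/-- `σ(s) = cos s − sin s = √2·cos(s − 7π/4)`: a pure cosine of the angular distance from the α-point `s = 7π/4`. -/
theorem axialRate_eq_sqrt_two_mul_cos (s : ℝ) :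
    Real.cos s - Real.sin s = Real.sqrt 2 * Real.cos (s - 7 * π / 4) := by
  rw [Real.cos_sub, ABCAlphaPointStrain.sin_seven_pi_div_four, ABCAlphaPointStrain.cos_seven_pi_div_four]
  have h2 : Real.sqrt 2 * Real.sqrt 2 = 2 := Real.mul_self_sqrt (by norm_num)
  linear_combination (-(Real.cos s) / 2 + Real.sin s / 2) * h2

/-- IN ARCLENGTH: the diagonal point at arclength `d` from `α₀` toward `β₀` is `(7π/4 − d/√3)·𝟙` (the line has
direction `𝟙/√3`), and there `σ = √2·cos(d/√3) = σ_α·cos(d/√3)`. -/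
theorem axialRate_arclength (d : ℝ) :
    Real.cos (7 * π / 4 - d / Real.sqrt 3) - Real.sin (7 * π / 4 - d / Real.sqrt 3) =
      Real.sqrt 2 * Real.cos (d / Real.sqrt 3) := by
  rw [axialRate_eq_sqrt_two_mul_cos]
  congr 1
  rw [show 7 * π / 4 - d / Real.sqrt 3 - 7 * π / 4 = -(d / Real.sqrt 3) by ring, Real.cos_neg]

/-- The arclength parametrisation is honest: `dist((7π/4 − d/√3)·𝟙, α₀) = |d|` — three equal coordinate offsets
`d/√3` have Euclidean length `|d|`. -/
theorem arclength_offset_norm (d : ℝ) :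
    Real.sqrt (3 * (d / Real.sqrt 3) ^ 2) = |d| := by
  have h3 : Real.sqrt 3 ^ 2 = 3 := Real.sq_sqrt (by norm_num)
  have : 3 * (d / Real.sqrt 3) ^ 2 = d ^ 2 := by
    rw [div_pow, h3]; ring
  rw [this, Real.sqrt_sq_eq_abs]

/-- At the MIDPOINT of the heteroclinic segment (`s = 5π/4`, arclength `π√3/2` from either end): `σ = 0` — no axial
strain; the host there only rotates the normal plane (at rate `(sin + cos)/2 = −√2/2`, the fastest station). The end
values `σ(7π/4) = +√2 = σ_α` and `σ(3π/4) = −√2` are `ABCAlphaPointStrain.alongLine_rate_alpha` / `alongLine_rate_beta`. -/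
theorem axialRate_mid : Real.cos (5 * π / 4) - Real.sin (5 * π / 4) = 0 := by
  have h : 5 * π / 4 = π / 4 + π := by ring
  rw [h, Real.cos_add_pi, Real.sin_add_pi, Real.cos_pi_div_four, Real.sin_pi_div_four]; ring

/-- THE α-WARD HALF STRETCHES: `σ(s) > 0` for `5π/4 < s < 9π/4` (on the heteroclinic segment `(3π/4, 7π/4)` this is
its α-ward half `(5π/4, 7π/4)`, and it persists past `α₀` up to `9π/4`). -/
theorem axialRate_pos {s : ℝ} (h1 : 5 * π / 4 < s) (h2 : s < 9 * π / 4) : 0 < Real.cos s - Real.sin s := by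
  rw [axialRate_eq_sqrt_two_mul_cos]
  refine mul_pos (Real.sqrt_pos.2 (by norm_num)) (Real.cos_pos_of_mem_Ioo ⟨?_, ?_⟩) <;> linarith

/-- THE β-WARD HALF COMPRESSES: `σ(s) < 0` for `π/4 < s < 5π/4` (on the segment: its β-ward half `(3π/4, 5π/4)`). -/
theorem axialRate_neg {s : ℝ} (h1 : π / 4 < s) (h2 : s < 5 * π / 4) : Real.cos s - Real.sin s < 0 := by
  rw [axialRate_eq_sqrt_two_mul_cos]
  have hc : Real.cos (s - 7 * π / 4) < 0 := by
    have e : Real.cos (s - 7 * π / 4) = Real.cos (s - 7 * π / 4 + 2 * π) := (Real.cos_add_two_pi _).symm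
    rw [e]
    apply Real.cos_neg_of_pi_div_two_lt_of_lt <;> linarith
  exact mul_neg_of_pos_of_neg (Real.sqrt_pos.2 (by norm_num)) hc

/-- `|σ(s)| ≤ √2 = σ_α` everywhere on the line: the α-point is the most stretching station the host offers (and β the
most compressing); cf. the GLOBAL bound `vᵀ∇U v ≤ √2|v|²` of `ABCHostStrainEnvelope`. -/
theorem abs_axialRate_le (s : ℝ) : |Real.cos s - Real.sin s| ≤ Real.sqrt 2 := by
  rw [axialRate_eq_sqrt_two_mul_cos, abs_mul, abs_of_nonneg (Real.sqrt_nonneg 2)]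
  exact mul_le_of_le_one_right (Real.sqrt_nonneg 2) (Real.abs_cos_le_one _)

/-- ONE-DIMENSIONAL CONTINUITY ON THE INVARIANT LINE: the axial strain rate is the `s`-derivative of the along-line
speed `w(s) = sin s + cos s` (`ABCAlphaPointStrain.hasDerivAt_alongLine`): `σ = dw/ds`. A rope segment between
stations `s₁ < s₂` on the α-ward half is stretched because its up-line end moves toward α faster than its down-line end. -/
theorem axialRate_eq_deriv_speed (s : ℝ) :
    deriv (fun s => Real.sin s + Real.cos s) s = Real.cos s - Real.sin s :=
  (ABCAlphaPointStrain.hasDerivAt_alongLine s).deriv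

/-! ## §4 Numbers for the census -/

/-- `(1/√3)² = 1/3`. -/
theorem one_div_sqrt_three_sq : (1 / Real.sqrt 3) ^ 2 = 1 / 3 := by
  rw [div_pow, one_pow, Real.sq_sqrt (by norm_num : (0:ℝ) ≤ 3)]

/-- `0.833 < cos(1/√3) < 0.84`: a rope centred ONE code unit (= `k⁻¹`) up-line from the α-point is strained axially at
`≈ 0.838 σ_α` (kernel bracket from `1 − x²/2 ≤ cos x` and `|cos x − (1 − x²/2)| ≤ (5/96)x⁴` at `x² = 1/3`). -/
theorem cos_one_div_sqrt_three_bounds :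
    (0.833 : ℝ) < Real.cos (1 / Real.sqrt 3) ∧ Real.cos (1 / Real.sqrt 3) < 0.84 := by
  have hsq := one_div_sqrt_three_sq
  have hx0 : 0 ≤ 1 / Real.sqrt 3 := by positivity
  constructor
  · have h := Real.one_sub_sq_div_two_le_cos (x := 1 / Real.sqrt 3)
    rw [hsq] at h
    linarith
  · have h1 : (1 : ℝ) ≤ Real.sqrt 3 := by
      rw [show (1 : ℝ) = Real.sqrt 1 from Real.sqrt_one.symm]
      exact Real.sqrt_le_sqrt (by norm_num)
    have habs : |1 / Real.sqrt 3| ≤ 1 := by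
      rw [abs_of_nonneg hx0, div_le_one (by linarith)]
      exact h1
    have h := Real.cos_bound habs
    rw [abs_of_nonneg hx0] at h
    have h4 : (1 / Real.sqrt 3) ^ 4 = 1 / 9 := by
      rw [show (4 : ℕ) = 2 * 2 from rfl, pow_mul, hsq]; norm_num
    rw [hsq, h4] at h
    have := (abs_le.1 h).2
    linarith

/-- HALF-STRAIN STATION: at `s = 7π/4 − π/3` (arclength `d = π√3/3 = π/√3 ≈ 1.81` from α, just over a third of the
way to β) the axial rate is exactly `σ_α/2 = √2/2`. -/
theorem axialRate_half_station :
    Real.cos (7 * π / 4 - π / 3) - Real.sin (7 * π / 4 - π / 3) = Real.sqrt 2 / 2 := by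
  rw [axialRate_eq_sqrt_two_mul_cos, show 7 * π / 4 - π / 3 - 7 * π / 4 = -(π / 3) by ring, Real.cos_neg,
    Real.cos_pi_div_three]
  ring

end Summit.NavierStokesRegularity.FluidComputer.ABCDiagonalStrainProfile
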